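import Summits.Ventures.QEC.Census.CertChunks
import Summits.Ventures.QEC.Census.BB.BB72.Cert
import HarnessLib

/-!
# `BB72` — KERNEL-tier lower-bound replay, side Z, leaf file 6/10 (emitted by qec-search-7)

Bruteforce replay (CERT-FORMAT v1 §5.1, lemma L3) of the certificate `7e943c5a566adc43`: every Z-type operator of weight
`1 … 5` has nonzero syndrome (rows `cert.HX`) or is allow-listed (allow-list []). This file holds
9 packed chunk evaluations (`chunk1R`/`chunk2R` of `Census/CertChunks.lean` over `posList 72 cert.HX`), total
1509344 scan end points, each closed by `decide +kernel` — tier KERNEL (CERTIFIED): axioms ⊆ {propext, Classical.choice,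
Quot.sound}. Assembled in `BB/BB72/KernelZ.lean`. Do not edit; re-emit (HOME/census/search-7/emit_kernel.py).
-/

namespace Summit.Ventures.QEC.Census.BB72

/-- Level-2 chunks `(9, j)`, `5 ≤ j < 13`, side Z of `BB72` (194398 end points): pass. -/
theorem kZ2_9_5 : chunk2R (leafTest []) (posList 72 cert.HX) 3 9 5 8 = true := by decide +kernel

/-- Level-2 chunks `(9, j)`, `13 ≤ j < 32`, side Z of `BB72` (199595 end points): pass. -/
theorem kZ2_9_13 : chunk2R (leafTest []) (posList 72 cert.HX) 3 9 13 19 = true := by decide +kernel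

/-- Level-2 chunks `(9, j)`, `32 ≤ j < 62`, side Z of `BB72` (31930 end points): pass. -/
theorem kZ2_9_32 : chunk2R (leafTest []) (posList 72 cert.HX) 3 9 32 30 = true := by decide +kernel

/-- Level-2 chunks `(10, j)`, `0 ≤ j < 6`, side Z of `BB72` (190906 end points): pass. -/
theorem kZ2_10_0 : chunk2R (leafTest []) (posList 72 cert.HX) 3 10 0 6 = true := by decide +kernel

/-- Level-2 chunks `(10, j)`, `6 ≤ j < 15`, side Z of `BB72` (189384 end points): pass. -/
theorem kZ2_10_6 : chunk2R (leafTest []) (posList 72 cert.HX) 3 10 6 9 = true := by decide +kernel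

/-- Level-2 chunks `(10, j)`, `15 ≤ j < 61`, side Z of `BB72` (179446 end points): pass. -/
theorem kZ2_10_15 : chunk2R (leafTest []) (posList 72 cert.HX) 3 10 15 46 = true := by decide +kernel

/-- Level-2 chunks `(11, j)`, `0 ≤ j < 6`, side Z of `BB72` (181145 end points): pass. -/
theorem kZ2_11_0 : chunk2R (leafTest []) (posList 72 cert.HX) 3 11 0 6 = true := by decide +kernel

/-- Level-2 chunks `(11, j)`, `6 ≤ j < 16`, side Z of `BB72` (192555 end points): pass. -/
theorem kZ2_11_6 : chunk2R (leafTest []) (posList 72 cert.HX) 3 11 6 10 = true := by decide +kernel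

/-- Level-2 chunks `(11, j)`, `16 ≤ j < 60`, side Z of `BB72` (149985 end points): pass. -/
theorem kZ2_11_16 : chunk2R (leafTest []) (posList 72 cert.HX) 3 11 16 44 = true := by decide +kernel

end Summit.Ventures.QEC.Census.BB72
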